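import Literature.Algebra.Polynomial.CasasAlvero.Degree5CharPLarge
import HarnessLib

/-!
# Casas-Alvero in degree 5 fails in characteristic 3541 — the ninth bad prime

The bad primes of degree `5` are `2, 3, 7, 11, 131, 193, 599, 3541, 8009` [Castryck–Laterveer–Ounaïes, Math. Comp. 83 (2014),
Thm. 4; Chellali–Salinier].  (ERRATUM for this directory: the module docstrings of `Degree5CharP.lean`, `Degree5CharPLarge.lean`
and `CharThirteenSharp.lean` misquote the ninth bad prime as `1451`; the published value is `3541`.  `1451` is not a bad prime,
which is why the seat-2 g4 search found no example there.)  Eight of the nine were already Lean theorems; here is the ninth: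
`X^5 - 10 X^3 + 9 X^2 = X^2 (X - 1)(X^2 + X - 9)` is a Casas-Alvero polynomial over every field of characteristic `3541`, with
prime-field witnesses `D¹ ↦ 0`, `D² ↦ 1974`, `D³ ↦ 1`, `D⁴ ↦ 0` (found by the elimination of `Degree5.lean`: in the scenario
"`θ₁ = 0`" the resultant of the two remaining binary cubics is `3^3 · 3541`, and `1974` is their unique common root mod `3541`).
Hence `¬ CA_5` over every field of characteristic `3541` (`not_holdsInDegree_five_of_char_3541`, stated with an explicit
`p = 3541` hypothesis so that its signature is not a syntactic duplicate of the characteristic-3 theorem).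
-/

noncomputable section

open Polynomial

namespace Literature.Algebra.Polynomial.CasasAlvero

variable (K : Type*) [Field K]

section Char3541
variable [CharP K 3541]

/-- `X^5 - 10 X^3 + 9 X^2` is Casas-Alvero in characteristic 3541 (witness roots D¹↦0, D²↦1974, D³↦1, D⁴↦0).
[cite: CastryckLaterveerOunaies2012, Thm. 4] -/
theorem isCasasAlvero_quintic_char_3541 : IsCasasAlvero (quinticNF K (-10) (9) (0)) := by
  have hp : (3541 : K) = 0 := by simpa using CharP.cast_eq_zero K 3541
  intro i hi0 hi
  rw [natDegree_quinticNF] at hi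
  unfold quinticNF
  interval_cases i
  · refine ⟨(0 : K), ?_, ?_⟩
    · simp only [eval_add, eval_pow, eval_X, eval_smul, smul_eq_mul]
      linear_combination (0 : K) * hp
    · simp only [map_add, map_smul, hasseDeriv_X_pow, eval_add, eval_mul, eval_C, eval_pow, eval_X, eval_smul, smul_eq_mul,
        show Nat.choose 5 1 = 5 from rfl, show Nat.choose 3 1 = 3 from rfl, show Nat.choose 2 1 = 2 from rfl, show Nat.choose 1 1 = 1 from rfl]
      push_cast
      linear_combination (0 : K) * hp
  · refine ⟨(1974 : K), ?_, ?_⟩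
    · simp only [eval_add, eval_pow, eval_X, eval_smul, smul_eq_mul]
      linear_combination (8464644064548 : K) * hp
    · simp only [map_add, map_smul, hasseDeriv_X_pow, eval_add, eval_mul, eval_C, eval_pow, eval_X, eval_smul, smul_eq_mul,
        show Nat.choose 5 2 = 10 from rfl, show Nat.choose 3 2 = 3 from rfl, show Nat.choose 2 2 = 1 from rfl, show Nat.choose 1 2 = 0 from rfl]
      push_cast
      linear_combination (21722769 : K) * hp
  · refine ⟨(1 : K), ?_, ?_⟩
    · simp only [eval_add, eval_pow, eval_X, eval_smul, smul_eq_mul]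
      linear_combination (0 : K) * hp
    · simp only [map_add, map_smul, hasseDeriv_X_pow, eval_add, eval_mul, eval_C, eval_pow, eval_X, eval_smul, smul_eq_mul,
        show Nat.choose 5 3 = 10 from rfl, show Nat.choose 3 3 = 1 from rfl, show Nat.choose 2 3 = 0 from rfl, show Nat.choose 1 3 = 0 from rfl]
      push_cast
      linear_combination (0 : K) * hp
  · refine ⟨(0 : K), ?_, ?_⟩
    · simp only [eval_add, eval_pow, eval_X, eval_smul, smul_eq_mul]
      linear_combination (0 : K) * hp
    · simp only [map_add, map_smul, hasseDeriv_X_pow, eval_add, eval_mul, eval_C, eval_pow, eval_X, eval_smul, smul_eq_mul,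
        show Nat.choose 5 4 = 5 from rfl, show Nat.choose 3 4 = 0 from rfl, show Nat.choose 2 4 = 0 from rfl, show Nat.choose 1 4 = 0 from rfl]
      push_cast
      linear_combination (0 : K) * hp

end Char3541

/-- CA₅ FAILS over every field of characteristic `p = 3541` (the ninth bad prime of degree 5; stated with an explicit `p` like
`not_holdsInDegree_five_of_charP_large`). [cite: CastryckLaterveerOunaies2012, Thm. 4] -/
theorem not_holdsInDegree_five_of_char_3541 (p : ℕ) [CharP K p] (hp : p = 3541) : ¬ HoldsInDegree K 5 := by
  subst hp
  exact not_holdsInDegree_five_of_quinticNF K (isCasasAlvero_quintic_char_3541 K) (by norm_num)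

end Literature.Algebra.Polynomial.CasasAlvero
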